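import Mathlib
import Summits.KontsevichZagierPeriods.Zeta5Search.Elimination.DiagonalPartner
import Summits.KontsevichZagierPeriods.Zeta5Search.WedgeDictionaryRankThreeProof
import Summits.KontsevichZagierPeriods.Zeta5Search.WedgeDictionaryCrossContiguity
import HarnessLib

/-!
# ζ(5) search — class `elim`: THE PENCIL RELATION OF THE ζ(3)-ELIMINANTS ALONG THE DIAGONAL (ρ-free core)
# (cell `pub-zeta5`, fam-elim gen 19, E-L17; add-on to E-L12 `Elimination/DiagonalPartner.lean` and to the
# D2 lane's `WedgeDictionaryThreeTerm.lean`, whose `DictPencil` is conjectural there)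

HONEST FRAMING: systematic search; no irrationality claim unless certified.

OUR work (Summit side; `families/elim/FAMILY.md` §17.15).  Write `D(x) = (U, W, V)(x)` (`coeffU/W/V`) for the
coefficient vector of the dual Brown–Zudilin form `F̃₇(x) = Uζ(5) + Wζ(3) − V` and
`C(x) = D(x) ∧ D(x + e₇)` for its SLOT-7 WEDGE, with Plücker coordinates `casUW x` (`U∧W`), `casUV x` (`U∧V`),
`casVW x` (`V∧W`): by E-L10/E-L11 the `ζ(3)`-eliminant of the contiguous pair `(x, x + e₇)` is
`W(x+e₇)F̃₇(x) − W(x)F̃₇(x+e₇) = casUW(x)·ζ(5) − casVW(x)`, so `C(x)` IS the eliminant (plus its companion minor).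
Let `b⁺ = dsShift b = (b₀ + 2; b_j + 1)` be the diagonal translate of the D2 lane's relation (DS)
(`WedgeDictionaryDiagonalShift`: `X(b⁺) = X(b + e₇) − λ₇(b)X(b)`, `λ₇ = dsLam b 6 = (b₇+1)(b₀−b₇+1)`),
`d = dOf b = 3b₀ − Σ b_j`, `cas3 b = det[D(b), D(b+e₇), D(b+2e₇)]` (CF-W3, `rankThreeClosedForm_holds`) and
`Π₇(b) = ∏_{k≤6} (b₀ − b₇ − b_k)` (`pencilPi`, the factor of `topGamma0_eq`).

THEOREM (PENCIL(·,7), ρ-free; `pencil_UW`, `pencil_UV`, `pencil_VW`).  For `b` in the box with `b₇ + 2 ≤ b₀`,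
`d(b) ≥ 2` and all pair sums `b_j + b_k ≤ b₀`, each wedge coordinate `X ∈ {U∧W, U∧V, V∧W}` satisfies

  `Π₇(b) · X(b⁺) = (∏_{k≤6} (b_k + 1)) · X(b + e₇) + (d(b) − 1)(b₀ − b₇ + 1) · X(b⁺ + e₇)`,

i.e. the eliminants at the three points `c = b + e₇` (base), `P = c⁺ = b⁺ + e₇` (apex) and `P − e₇ = b⁺` of
gen-1's "pencil" are linearly dependent over `ℚ` with EXPLICIT PRODUCT coefficients.  Proof (identities only):
* (T1) Cramer's syzygy (`cramer_wedge_syzygy`): for `u₁, u₂, u₃, w ∈ ℚ³`,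
  `det(u₂,u₃,w)(u₁∧w) − det(u₁,u₃,w)(u₂∧w) + det(u₁,u₂,w)(u₃∧w) = 0`;
* (T2) `pencil_cas3`: (DS) at `b`, `b+e₇`, `b+2e₇` (`dictionary_dsShift7`) and `(b+e₇)⁺ = b⁺+e₇` (`bump_dsShift`)
  turn (T1) with `u₁ = D(b+e₇)`, `u₂ = D(b⁺)`, `u₃ = D((b+2e₇)⁺)`, `w = D(b⁺+e₇)` into
  `cas3(b+e₇)·X(b⁺) = cas3(b⁺)·X(b+e₇) + λ₇(b)·cas3(b)·X(b⁺+e₇)` (one `ring` per coordinate);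
* (R1) `cas3_bump6`: Abel's step `cas3_abel_step` in closed form, `(d−1)·cas3(b+e₇) = (b₇+1)·Π₇(b)·cas3(b)`;
* (T3) `cas3_dsShift`: CF-W3 at `b` and at `b⁺` (same pair-factorial product `pairProd_dsShift`, slot factorials
  `slotFactorials_dsShift`, `d(b⁺) = d(b) − 1`, sign unchanged) give `(d−1)·cas3(b⁺) = ∏_{j≤7}(b_j+1)·cas3(b)`,
  and `cas3(b) ≠ 0` (`cas3_ne_zero`);
* (T4) `pencil_of_cas3`: multiply (T2) by `d − 1`, substitute (R1), (T3), `λ₇ = (b₇+1)(b₀−b₇+1)`, cancel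
  `(b₇+1)·cas3(b) ≠ 0`.
Exact canary (in-seat, < 4 s, `pub-zeta5-fam-elim/g19/pencil_check.py` over gen-1's `cfw3_ref.py`): (T2), (T3) and
PENCIL(·,7) hold at 19/19 admissible test shapes, including gen-1 g15's memo point `c = (13; 4,5,4,4,4,4,3)`.

BRIDGE TO `WedgeDictionaryThreeTerm.DictPencil` (gen-1's to execute; a recipe, not claimed here): with
`c = b + e₇ = bOfA a`, `P = c⁺`: `d(b) − 1 = d(c)`, `b₀ − b₇ + 1 = c₀ + 2 − c₇`,
`Π₇(b) = ∏_{k≤6}(P₀ + 1 − P₇ − P_k)`; multiplying by the gauge factors `ρ` of the dictionary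
(`ρ(c⁺)/ρ(c) = −d(c)/∏_{j∈{1,4,5,6,7}}(c_j+1)`, `ρ(P − s₇)/ρ(P)`) turns `(∏_{k≤6}(b_k+1) : d(c)(c₀+2−c₇) : −Π₇(b))`
into `(pencilBase c : pencilApex c 7 : fanCoeff P 7)`; the `Q`-coordinate is unconditional (`wedgeDictionary_Q`),
the `P̂`/`P`-coordinates go through the dictionary's `P̂`/`P` parts; a general slot `i` (third point `P − e_i`):
the S₇-transport of this file (`coeffU/W/V_permLower`; slots `i ↔ 7` swapped in BOTH the shift and the wedge partner)
gives the pencil for the slot-`i` wedges `D(x) ∧ D(x+e_i)` at `b⁺, b+e_i, b⁺+e_i`, and partner independence (E-L10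
`partnerElim_partner_independent`: an explicit point-dependent rational factor, part of the gauge) converts back to
slot-7 wedges; STAR(i,k) = PENCIL(·,k) − PENCIL(·,i).

READING for the class (T4, structural): together with E-L12 (the diagonal partner `b⁺` of `b` gives Brown–Zudilin's own
eliminant) this prices the diagonal translate of a CONTIGUOUS pair: its eliminant `C(b⁺)` is a fixed two-term
`ℚ`-combination of the contiguous eliminants `C(b+e₇)`, `C(b⁺+e₇)` — no new linear forms in `1, ζ(5)`; verdict
unchanged (T1 NO / T2 NO / T4 YES).  What this is NOT: anything about sizes, denominators, valuations or
irrationality; `DictPencil`/`DictStar` themselves (ρ-bookkeeping, other slots) are NOT proved here.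
-/

noncomputable section

open Finset

namespace Summit.KontsevichZagierPeriods.Zeta5Search.Elimination

open Summit.KontsevichZagierPeriods.Zeta5Search.DualSeries (InBox)
open Summit.KontsevichZagierPeriods.Zeta5Search.WedgeDictionary

/-! ### (T1) The mechanism: Cramer's syzygy for three wedges through a common vector -/

/-- **(T1) Cramer's syzygy.** For `u₁ = x, u₂ = y, u₃ = z, w ∈ ℚ³`:
`det(u₂,u₃,w)·(u₁∧w) − det(u₁,u₃,w)·(u₂∧w) + det(u₁,u₂,w)·(u₃∧w) = 0` — here its `(0,1)` Plücker coordinate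
(the others follow by permuting coordinates).  It is the wedge with `w` of the four-vector dependence
`Σ ± det(three of u₁,u₂,u₃,w)·(the fourth) = 0` in `ℚ³`. -/
theorem cramer_wedge_syzygy (x₀ x₁ x₂ y₀ y₁ y₂ z₀ z₁ z₂ w₀ w₁ w₂ : ℚ) :
    (y₀ * (z₁ * w₂ - z₂ * w₁) - y₁ * (z₀ * w₂ - z₂ * w₀) + y₂ * (z₀ * w₁ - z₁ * w₀)) * (x₀ * w₁ - w₀ * x₁) -
        (x₀ * (z₁ * w₂ - z₂ * w₁) - x₁ * (z₀ * w₂ - z₂ * w₀) + x₂ * (z₀ * w₁ - z₁ * w₀)) * (y₀ * w₁ - w₀ * y₁) +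
      (x₀ * (y₁ * w₂ - y₂ * w₁) - x₁ * (y₀ * w₂ - y₂ * w₀) + x₂ * (y₀ * w₁ - y₁ * w₀)) * (z₀ * w₁ - w₀ * z₁) = 0 := by
  ring

/-! ### Bookkeeping along the diagonal -/

/-- The diagonal translate commutes with the slot-7 unit step: `(b + e₇)⁺ = b⁺ + e₇`. -/
theorem bump_dsShift (b : ℕ → ℤ) : bump (dsShift b) 6 = dsShift (bump b 6) := by
  funext j
  by_cases hj : j = 6 + 1
  · subst hj
    rw [bump_self, dsShift_succ, dsShift_succ, bump_self]
  · rw [bump_of_ne _ hj]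
    rcases j with _ | j
    · rw [dsShift_zero, dsShift_zero, bump_zero]
    · rw [dsShift_succ, dsShift_succ, bump_of_ne _ hj]

/-- Off slot `0` the diagonal translate adds one: `b⁺_j = b_j + 1` for `j ≥ 1`. -/
theorem dsShift_of_pos (b : ℕ → ℤ) {j : ℕ} (hj : 1 ≤ j) : dsShift b j = b j + 1 := by
  obtain ⟨k, rfl⟩ : ∃ k, j = k + 1 := ⟨j - 1, by omega⟩
  exact dsShift_succ b k

/-- `(b + 2e₇)₇ = b₇ + 2` and `(b + 2e₇)₀ = b₀`. -/
theorem bump6_bump6_seven (b : ℕ → ℤ) : bump (bump b 6) 6 7 = b 7 + 2 ∧ bump (bump b 6) 6 0 = b 0 := by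
  refine ⟨?_, ?_⟩
  · rw [bump6_seven, bump6_seven]; ring
  · rw [bump_zero, bump_zero]

/-- (DS) along slot 7 in `bump` notation: `X(b⁺) = X(b + e₇) − λ₇(b)·X(b)` for `X ∈ {U, W, V}`
(`dictionary_dsShift` at `i = 6`: `b` in the box, `d(b) ≥ 0`, `b₇ ≤ b₀`). -/
theorem dictionary_dsShift7 (b : ℕ → ℤ) (hb : InBox b) (hd : 0 ≤ dOf b) (h7 : b 7 ≤ b 0) :
    coeffU (dsShift b) = coeffU (bump b 6) - dsLam b 6 * coeffU b ∧
      coeffW (dsShift b) = coeffW (bump b 6) - dsLam b 6 * coeffW b ∧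
        coeffV (dsShift b) = coeffV (bump b 6) - dsLam b 6 * coeffV b :=
  dictionary_dsShift b hb hd (i := 6) (mem_range.2 (by norm_num)) h7

/-! ### (T2) The pencil relation with `cas3` coefficients -/

/-- **(T2)** Cramer's syzygy on (DS) at `b`, `b + e₇`, `b + 2e₇`: for each slot-7 wedge coordinate
`X ∈ {U∧W, U∧V, V∧W}` (`casUW`, `casUV`, `casVW`),
`cas3(b + e₇)·X(b⁺) = cas3(b⁺)·X(b + e₇) + λ₇(b)·cas3(b)·X(b⁺ + e₇)`
(`b` in the box, `d(b) ≥ 2`, `b₇ + 2 ≤ b₀`). -/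
theorem pencil_cas3 (b : ℕ → ℤ) (hb : InBox b) (hd : 2 ≤ dOf b) (h7 : b 7 + 2 ≤ b 0) :
    (cas3 (bump b 6) * casUW (dsShift b) =
        cas3 (dsShift b) * casUW (bump b 6) + dsLam b 6 * cas3 b * casUW (bump (dsShift b) 6)) ∧
      (cas3 (bump b 6) * casUV (dsShift b) =
          cas3 (dsShift b) * casUV (bump b 6) + dsLam b 6 * cas3 b * casUV (bump (dsShift b) 6)) ∧
        (cas3 (bump b 6) * casVW (dsShift b) =
            cas3 (dsShift b) * casVW (bump b 6) + dsLam b 6 * cas3 b * casVW (bump (dsShift b) 6)) := by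
  obtain ⟨e27, e20⟩ := bump6_bump6_seven b
  have hb1 : InBox (bump b 6) := inBox_bump6 b hb (by omega)
  have hb2 : InBox (bump (bump b 6) 6) := inBox_bump6 _ hb1 (by rw [bump6_seven, bump_zero]; omega)
  have hd1 : dOf (bump b 6) = dOf b - 1 := dOf_bump b (mem_range.2 (by norm_num))
  have hd2 : dOf (bump (bump b 6) 6) = dOf b - 2 := by
    have h := dOf_bump (bump b 6) (i := 6) (mem_range.2 (by norm_num))
    rw [h, hd1]; ring
  obtain ⟨hU0, hW0, hV0⟩ := dictionary_dsShift7 b hb (by omega) (by omega)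
  obtain ⟨hU1, hW1, hV1⟩ :=
    dictionary_dsShift7 (bump b 6) hb1 (by rw [hd1]; omega) (by rw [bump6_seven, bump_zero]; omega)
  obtain ⟨hU2, hW2, hV2⟩ :=
    dictionary_dsShift7 (bump (bump b 6) 6) hb2 (by rw [hd2]; omega) (by rw [e27, e20]; omega)
  refine ⟨?_, ?_, ?_⟩
  · unfold cas3 casUW
    simp only [bump_dsShift, hU0, hW0, hV0, hU1, hW1, hV1, hU2, hW2, hV2]
    ring
  · unfold cas3 casUV
    simp only [bump_dsShift, hU0, hW0, hV0, hU1, hW1, hV1, hU2, hW2, hV2]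
    ring
  · unfold cas3 casVW
    simp only [bump_dsShift, hU0, hW0, hV0, hU1, hW1, hV1, hU2, hW2, hV2]
    ring

/-! ### (R1), (T3): the two `cas3` ratios in closed form, and `cas3 ≠ 0` -/

/-- `Π₇(b) = ∏_{k ≤ 6} (b₀ − b₇ − b_k)`, the non-degeneracy factor of the four-term relation (`topGamma0_eq`). -/
def pencilPi (b : ℕ → ℤ) : ℚ := ∏ k ∈ range 6, ((b 0 : ℚ) - b 7 - b (k + 1))

/-- **(R1)** Abel's step `cas3_abel_step` in closed form: `(d(b) − 1)·cas3(b + e₇) = (b₇ + 1)·Π₇(b)·cas3(b)`. -/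
theorem cas3_bump6 (b : ℕ → ℤ) (hb : InBox b) (hd : 2 ≤ dOf b) (h7 : b 7 + 2 ≤ b 0) :
    ((dOf b : ℚ) - 1) * cas3 (bump b 6) = ((b 7 : ℚ) + 1) * pencilPi b * cas3 b := by
  have h := cas3_abel_step b hb hd h7
  rw [topGamma3_eq, topGamma0_eq] at h
  unfold pencilPi
  linear_combination -h

/-- The pair-factorial product of CF-W3 is the same at `b⁺` and at `b` (`b⁺₀ − b⁺_j − b⁺_k = b₀ − b_j − b_k`). -/
theorem pairProd_dsShift (b : ℕ → ℤ) :
    (allPairs.map fun jk => ((dsShift b 0 - dsShift b jk.1 - dsShift b jk.2).toNat.factorial : ℚ)).prod =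
      (allPairs.map fun jk => ((b 0 - b jk.1 - b jk.2).toNat.factorial : ℚ)).prod := by
  congr 1
  refine List.map_congr_left fun jk hjk => ?_
  obtain ⟨h1, h12, -⟩ := allPairs_bounds jk hjk
  rw [dsShift_zero, dsShift_of_pos b h1, dsShift_of_pos b (show 1 ≤ jk.2 by omega),
    show b 0 + 2 - (b jk.1 + 1) - (b jk.2 + 1) = b 0 - b jk.1 - b jk.2 by ring]

/-- The pair-factorial product of CF-W3 never vanishes. -/
theorem pairProd_ne_zero (b : ℕ → ℤ) :
    (allPairs.map fun jk => ((b 0 - b jk.1 - b jk.2).toNat.factorial : ℚ)).prod ≠ 0 :=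
  (List.prod_pos fun x hx => by
    obtain ⟨jk, -, rfl⟩ := List.mem_map.1 hx
    positivity).ne'

/-- Slot factorials of the diagonal translate: `∏_j (b_j + 1)! = ∏_j (b_j + 1) · ∏_j b_j!` (`b` in the box). -/
theorem slotFactorials_dsShift (b : ℕ → ℤ) (hb : InBox b) :
    ∏ j ∈ range 7, ((dsShift b (j + 1)).toNat.factorial : ℚ) =
      (∏ j ∈ range 7, ((b (j + 1) : ℚ) + 1)) * ∏ j ∈ range 7, ((b (j + 1)).toNat.factorial : ℚ) := by
  rw [← prod_mul_distrib]
  refine prod_congr rfl fun j hj => ?_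
  rw [dsShift_succ]
  exact toNat_factorial_succ _ (hb.2 j hj).1

/-- `cas3(b) ≠ 0` on the CF-W3 region (its closed form is `± 4 (d−1)! ∏_j b_j! / ∏_{j<k} (b₀ − b_j − b_k)!`). -/
theorem cas3_ne_zero (b : ℕ → ℤ) (hb : InBox b) (h7 : b 7 + 2 ≤ b 0) (hd : 1 ≤ dOf b)
    (hpairs : ∀ jk ∈ allPairs, b jk.1 + b jk.2 ≤ b 0) : cas3 b ≠ 0 := by
  intro h
  have H0 := rankThreeClosedForm_holds b hb h7 hd hpairs
  rw [h, zero_mul] at H0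
  exact mul_ne_zero (mul_ne_zero (mul_ne_zero (pow_ne_zero _ (by norm_num)) (by norm_num))
    (Nat.cast_ne_zero.2 (Nat.factorial_ne_zero _)))
    (prod_ne_zero_iff.2 fun j _ => Nat.cast_ne_zero.2 (Nat.factorial_ne_zero _)) H0.symm

/-- **(T3)** `cas3` along the diagonal: `(d(b) − 1)·cas3(b⁺) = ∏_{j=1}^{7} (b_j + 1) · cas3(b)` — CF-W3
(`rankThreeClosedForm_holds`) at `b` and at `b⁺`: same pair-factorial product, `d(b⁺) = d(b) − 1`, every slot
factorial gains one factor, and the sign `(−1)^{b₀+1}` is unchanged since `b⁺₀ = b₀ + 2`. -/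
theorem cas3_dsShift (b : ℕ → ℤ) (hb : InBox b) (h7 : b 7 + 2 ≤ b 0) (hd : 2 ≤ dOf b)
    (hpairs : ∀ jk ∈ allPairs, b jk.1 + b jk.2 ≤ b 0) :
    ((dOf b : ℚ) - 1) * cas3 (dsShift b) = (∏ j ∈ range 7, ((b (j + 1) : ℚ) + 1)) * cas3 b := by
  have hps : ∀ jk ∈ allPairs, dsShift b jk.1 + dsShift b jk.2 ≤ dsShift b 0 := by
    intro jk hjk
    obtain ⟨h1, h12, -⟩ := allPairs_bounds jk hjk
    rw [dsShift_zero, dsShift_of_pos b h1, dsShift_of_pos b (show 1 ≤ jk.2 by omega)]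
    have := hpairs jk hjk
    omega
  have H0 := rankThreeClosedForm_holds b hb h7 (by omega) hpairs
  have H1 := rankThreeClosedForm_holds (dsShift b) (inBox_dsShift hb)
    (by rw [dsShift_zero, dsShift_of_pos b (show 1 ≤ 7 by norm_num)]; omega) (by rw [dOf_dsShift]; omega) hps
  rw [pairProd_dsShift, slotFactorials_dsShift b hb, toNat_dsShift_zero hb, dOf_dsShift] at H1
  obtain ⟨m, hm⟩ : ∃ m : ℤ, dOf b - 2 = m := ⟨_, rfl⟩
  have hm0 : 0 ≤ m := by omega
  rw [show dOf b - 1 = m + 1 by omega, toNat_factorial_succ m hm0] at H0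
  rw [show dOf b - 1 - 1 = m by omega] at H1
  have hmq : (m : ℚ) = (dOf b : ℚ) - 2 := by rw [← hm]; push_cast; ring
  set PP := (allPairs.map fun jk => ((b 0 - b jk.1 - b jk.2).toNat.factorial : ℚ)).prod with hPP
  set F := ∏ j ∈ range 7, ((b (j + 1)).toNat.factorial : ℚ) with hF
  set B := ∏ j ∈ range 7, ((b (j + 1) : ℚ) + 1) with hB
  set M := ((m.toNat.factorial : ℕ) : ℚ) with hM
  apply mul_right_cancel₀ (pairProd_ne_zero b)
  linear_combination ((dOf b : ℚ) - 1) * H1 - B * H0 - (4 * (-1 : ℚ) ^ ((b 0).toNat + 1) * M * B * F) * hmq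

/-! ### (T4) PENCIL(·,7) with product coefficients -/

/-- The scalar skeleton of the last step: (T2) for one wedge coordinate `X` (`X₀ = X(b⁺)`, `X₁ = X(b+e₇)`,
`X₂ = X(b⁺+e₇)`; `c, c₁, c₂ = cas3` at `b, b+e₇, b⁺`), (R1), (T3), `λ₇ = β·A` and `c·β ≠ 0` give
`Π·X₀ = B₆·X₁ + δA·X₂`. -/
theorem pencil_of_cas3 {c c₁ c₂ X₀ X₁ X₂ lam Pi B₆ β A δ : ℚ} (hT2 : c₁ * X₀ = c₂ * X₁ + lam * c * X₂)
    (hR1 : δ * c₁ = β * Pi * c) (hT3 : δ * c₂ = B₆ * β * c) (hlam : lam = β * A) (hc : c ≠ 0) (hβ : β ≠ 0) :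
    Pi * X₀ = B₆ * X₁ + δ * A * X₂ := by
  apply mul_left_cancel₀ (mul_ne_zero hc hβ)
  linear_combination δ * hT2 - X₀ * hR1 + X₁ * hT3 + δ * c * X₂ * hlam

/-- **PENCIL(·,7), ρ-free — the `U∧W` coordinate** (the `ζ(5)`-coefficient of the eliminant).  For `b` in the box
with `b₇ + 2 ≤ b₀`, `d(b) ≥ 2` and all pair sums `≤ b₀`:
`Π₇(b)·(U∧W)(b⁺) = ∏_{k≤6}(b_k + 1)·(U∧W)(b + e₇) + (d(b) − 1)(b₀ − b₇ + 1)·(U∧W)(b⁺ + e₇)`. -/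
theorem pencil_UW (b : ℕ → ℤ) (hb : InBox b) (h7 : b 7 + 2 ≤ b 0) (hd : 2 ≤ dOf b)
    (hpairs : ∀ jk ∈ allPairs, b jk.1 + b jk.2 ≤ b 0) :
    pencilPi b * casUW (dsShift b) =
      (∏ k ∈ range 6, ((b (k + 1) : ℚ) + 1)) * casUW (bump b 6) +
        ((dOf b : ℚ) - 1) * ((b 0 : ℚ) - b 7 + 1) * casUW (bump (dsShift b) 6) := by
  have hT3 := cas3_dsShift b hb h7 hd hpairs
  rw [prod_range_succ, show (6 + 1 : ℕ) = 7 from rfl] at hT3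
  have h70 : (0 : ℤ) ≤ b 7 := (hb.2 6 (by simp)).1
  exact pencil_of_cas3 (pencil_cas3 b hb hd h7).1 (cas3_bump6 b hb hd h7) hT3 rfl
    (cas3_ne_zero b hb h7 (by omega) hpairs) (by positivity)

/-- **PENCIL(·,7), ρ-free — the `U∧V` coordinate** (the companion minor; conjecturally the `P̂`-part up to `ρ`). -/
theorem pencil_UV (b : ℕ → ℤ) (hb : InBox b) (h7 : b 7 + 2 ≤ b 0) (hd : 2 ≤ dOf b)
    (hpairs : ∀ jk ∈ allPairs, b jk.1 + b jk.2 ≤ b 0) :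
    pencilPi b * casUV (dsShift b) =
      (∏ k ∈ range 6, ((b (k + 1) : ℚ) + 1)) * casUV (bump b 6) +
        ((dOf b : ℚ) - 1) * ((b 0 : ℚ) - b 7 + 1) * casUV (bump (dsShift b) 6) := by
  have hT3 := cas3_dsShift b hb h7 hd hpairs
  rw [prod_range_succ, show (6 + 1 : ℕ) = 7 from rfl] at hT3
  have h70 : (0 : ℤ) ≤ b 7 := (hb.2 6 (by simp)).1
  exact pencil_of_cas3 (pencil_cas3 b hb hd h7).2.1 (cas3_bump6 b hb hd h7) hT3 rfl
    (cas3_ne_zero b hb h7 (by omega) hpairs) (by positivity)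

/-- **PENCIL(·,7), ρ-free — the `V∧W` coordinate** (the constant term of the eliminant: `−(V∧W)(x)` is the
`1`-coefficient of `W(x+e₇)F̃₇(x) − W(x)F̃₇(x+e₇)`). -/
theorem pencil_VW (b : ℕ → ℤ) (hb : InBox b) (h7 : b 7 + 2 ≤ b 0) (hd : 2 ≤ dOf b)
    (hpairs : ∀ jk ∈ allPairs, b jk.1 + b jk.2 ≤ b 0) :
    pencilPi b * casVW (dsShift b) =
      (∏ k ∈ range 6, ((b (k + 1) : ℚ) + 1)) * casVW (bump b 6) +
        ((dOf b : ℚ) - 1) * ((b 0 : ℚ) - b 7 + 1) * casVW (bump (dsShift b) 6) := by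
  have hT3 := cas3_dsShift b hb h7 hd hpairs
  rw [prod_range_succ, show (6 + 1 : ℕ) = 7 from rfl] at hT3
  have h70 : (0 : ℤ) ≤ b 7 := (hb.2 6 (by simp)).1
  exact pencil_of_cas3 (pencil_cas3 b hb hd h7).2.2 (cas3_bump6 b hb hd h7) hT3 rfl
    (cas3_ne_zero b hb h7 (by omega) hpairs) (by positivity)

end Summit.KontsevichZagierPeriods.Zeta5Search.Elimination

end
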